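import Literature.NumberTheory.EllipticCurves.ExceptionalPrimesDensityTransfer
import Literature.NumberTheory.EllipticCurves.BSDSelmerSmithCasesProofs
import HarnessLib

/-!
# Exceptional primes do not depend on the Weierstrass model; Duke 1997 for every model of `E_{A,B}`

Theorems only (no definition, no named fact). `ExceptionalPrimesDensityTransfer.lean` proves, from
Duke's Theorem 1 (`Duke1997_exceptionalPrimes_densityZero`), that the curves `E_{A,B}` with no
exceptional prime have naive-height density one in the tree's Bhargava–Shankar ordering, with the
surjectivity predicate evaluated on the short model `shortWeierstrass AB`. The consumer in the
bsd-percentage bundle (`PERCENT-FULL.md` §5, binder `hDuke`) quantifies instead over every curve `W`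
isomorphic to `E_{A,B}` (a globally minimal model, where the reduction predicates live). This file
supplies the bridge:

* `hasSurjectiveModNGaloisRep_smul` / `hasSurjectiveModNGaloisRep_smul_iff` — surjectivity of
  `ρ̄_{E,n}` is invariant under a change of Weierstrass model `W ↦ C • W` (the `Γ_ℚ`-equivariant
  isomorphism `E[n] ≃ (C • E)[n]`, `exists_geomTorsion_addEquiv_smul`; Silverman *AEC* III.3.1(b),
  VII.1); hence `isExceptionalPrime_smul_iff`;
* `heightDensityGE_forall_surj_of_duke` — Duke's theorem in the consumer's shape: a proportion one
  (lower density) of `(A, B)` have `ρ̄_{W,p}` surjective for EVERY prime `p` and EVERY model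
  `W = C • E_{A,B}`.
-/

noncomputable section

open scoped Classical

open WeierstrassCurve Filter Topology

namespace Literature.NumberTheory.EllipticCurves

/-- **Surjectivity of `ρ̄_{E,n}` is model-independent**: if `ρ̄_{W,n} : Γ_ℚ → Aut(W[n])` is
surjective then so is `ρ̄_{C • W,n}` for every change of variables `C` — transport along the
`Γ_ℚ`-equivariant `W[n] ≃+ (C • W)[n]` (`exists_geomTorsion_addEquiv_smul`; Silverman, *AEC*,
III.3.1(b)). [folklore] -/
theorem hasSurjectiveModNGaloisRep_smul (W : WeierstrassCurve ℚ) (C : VariableChange ℚ) (n : ℤ)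
    (h : W.HasSurjectiveModNGaloisRep n) : (C • W).HasSurjectiveModNGaloisRep n := by
  obtain ⟨e, he⟩ := exists_geomTorsion_addEquiv_smul W C n
  intro g
  set g' : geomTorsion (C • W) n ≃+ geomTorsion (C • W) n := Multiplicative.toAdd g with hg'
  obtain ⟨σ, hσ⟩ := h (Multiplicative.ofAdd (e.trans (g'.trans e.symm)))
  have hσP : ∀ P : geomTorsion W n, σ • P = e.symm (g' (e P)) := fun P ↦ by
    rw [← galoisRepTorsion_apply, hσ]
    rfl
  refine ⟨σ, Multiplicative.toAdd.injective (AddEquiv.ext fun Q ↦ ?_)⟩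
  obtain ⟨P, rfl⟩ := e.surjective Q
  rw [galoisRepTorsion_apply, ← he, hσP, AddEquiv.apply_symm_apply]

/-- `ρ̄_{C • W,n}` is surjective iff `ρ̄_{W,n}` is (apply the previous lemma to `C` and to `C⁻¹`).
[folklore] -/
theorem hasSurjectiveModNGaloisRep_smul_iff (W : WeierstrassCurve ℚ) (C : VariableChange ℚ)
    (n : ℤ) : (C • W).HasSurjectiveModNGaloisRep n ↔ W.HasSurjectiveModNGaloisRep n := by
  refine ⟨fun h ↦ ?_, hasSurjectiveModNGaloisRep_smul W C n⟩
  have := hasSurjectiveModNGaloisRep_smul (C • W) C⁻¹ n h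
  rwa [inv_smul_smul] at this

/-- Exceptional primes are model-independent. [folklore] -/
theorem isExceptionalPrime_smul_iff (W : WeierstrassCurve ℚ) (C : VariableChange ℚ) (N : ℕ) :
    IsExceptionalPrime (C • W) N ↔ IsExceptionalPrime W N := by
  unfold IsExceptionalPrime
  rw [hasSurjectiveModNGaloisRep_smul_iff]

/-- **Duke 1997 in the consumer's shape** (`PERCENT-FULL.md` §5, binder `hDuke`): granted Duke's
Theorem 1 (`Duke1997_exceptionalPrimes_densityZero`), at least a proportion `1` (lower naive-height
density one, Bhargava–Shankar ordering) of the pairs `(A, B)` have the property that for EVERY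
Weierstrass model `W = C • E_{A,B}` of `E_{A,B}` and EVERY prime `p`, `ρ̄_{W,p}` is surjective.
(`heightDensityGE_noExceptionalPrime_of_duke` + model-independence.) [cite: Duke1997, Thm. 1 (p. 815)] -/
theorem heightDensityGE_forall_surj_of_duke (hD : Duke1997_exceptionalPrimes_densityZero) :
    HeightDensityGE (fun AB ↦ ∀ (W : WeierstrassCurve ℚ) (C : VariableChange ℚ),
      C • shortWeierstrass AB = W → ∀ (p : ℕ) [Fact p.Prime], W.HasSurjectiveModNGaloisRep p) 1 := by
  have h := heightDensityGE_noExceptionalPrime_of_duke hD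
  intro ε hε
  filter_upwards [h ε hε] with X hX
  refine le_trans hX ?_
  -- pointwise implication ⇒ monotone proportions (sums of indicators)
  unfold heightProportion heightAverage
  refine div_le_div_of_nonneg_right ?_ (Nat.cast_nonneg _)
  refine Finset.sum_le_sum fun AB _ ↦ ?_
  by_cases hno : ∀ N : ℕ, ¬ IsExceptionalPrime (shortWeierstrass AB) N
  · have hyes : ∀ (W : WeierstrassCurve ℚ) (C : VariableChange ℚ),
        C • shortWeierstrass AB = W → ∀ (p : ℕ) [Fact p.Prime], W.HasSurjectiveModNGaloisRep p := by
      intro W C hW p hp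
      subst hW
      rw [hasSurjectiveModNGaloisRep_smul_iff]
      have := hno p
      unfold IsExceptionalPrime at this
      by_contra hns
      exact this ⟨hp.out, hns⟩
    rw [if_pos hno, if_pos]
    exact hyes
  · rw [if_neg hno]
    split_ifs <;> norm_num

end Literature.NumberTheory.EllipticCurves

end
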